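import Summits.AtomisticToContinuum.BoseEinsteinCondensation.Theorems.BECThomsonPrincipleGaussianDominationCanWardSplitDefs
import HarnessLib

/-!
# Line `ward-chord-splitting` of crux `GaussianDominationCan` (stmt-AtomisticToContinuum-9479): the compositions

Kernel-checked reductions of the line (second line lead), over the vocabulary of
`BECThomsonPrincipleGaussianDominationCanWardSplitDefs.lean`:

* `cnumberGD_of : WardChord → WeakDensityChord → BackflowChord → CNumberGD` — the splitting: `|k|²X = kCurrent − R`,
  `‖kCurrent‖ ≤ (|k|²/2)(|D₀|+|D₁|) + |Im W₀| + |Im W₁|`, square forms of the five chords at one state, Cauchy–Schwarz,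
  `k∞² ≤ |k|² ≤ 3k∞²`, `k∞²L²/‖n‖² = 4π²`; constants `ρ₀ := min`, `N₀ := max (max N₂ N₃) 1`, `C := 10 + 120π²C₂ + 20C₃`.
* `backflowChord_of_cnumberGD : WardChord → WeakDensityChord → CNumberGD → BackflowChord` — §A of triage r1-3 as a
  theorem: modulo S1 ∧ S2 the backflow chord S3 and c-number Gaussian domination are EQUIVALENT (the line's gain over
  the crux is structural — an operator with no condensate leg — not logical).
* `gaussianDominationCan_of_stubs : S2 → S3 → S4 → BECThomsonPrinciple.GaussianDominationCan` — the three registered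
  stubs imply the crux BY NAME (`gaussianDominationCan_iff`, `Iff.rfl`, Negative/CruxForms).

All statements are [folklore]-level algebra on chords (`F² ≤ 4c(E − E₀)` ⇔ `E₀ + sF ≤ E + cs²` for all `s ≥ 0`).
-/

noncomputable section

namespace Summit.AtomisticToContinuum.BoseEinsteinCondensation.Cruxes.GaussianDominationCan.WardChordSplitting

open MeasureTheory
open scoped ENNReal ComplexConjugate
open Literature.MathematicalPhysics.QuantumManyBody.BoseGas
open Summit.AtomisticToContinuum.BoseEinsteinCondensation.Theses
open Summit.AtomisticToContinuum.BoseEinsteinCondensation.Theorems.GaussianDominationCan.Negative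
open Summit.AtomisticToContinuum.BoseEinsteinCondensation.Cruxes.DensityResponse.ForceBalanceConstitutive
  (kvec ksq ksupSq ksupSq_le_ksq ksq_le_three_mul_ksupSq)

/-! ### Norm bookkeeping for the splitting -/

section Lemmas

variable {N : ℕ} {L : ℝ}

/-- `‖kCurrent‖ ≤ (|k|²/2)(|D₀| + |D₁|) + |Im W₀| + |Im W₁|` (`·₁ = ·_{-π/2}`). [folklore] -/
theorem norm_kCurrent_le (n : Fin 3 → ℤ) (Φ : PeriodicTrialState N L) :
    ‖kCurrent n Φ‖ ≤ ksq L n / 2 * |densityWave 0 n Φ| + ksq L n / 2 * |densityWave (-(Real.pi / 2)) n Φ| +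
      (|(phasedCurrent 0 n Φ).im| + |(phasedCurrent (-(Real.pi / 2)) n Φ).im|) := by
  unfold kCurrent
  have hk : 0 ≤ ksq L n / 2 := by have := ksq_nonneg L n; positivity
  have h1 : ∀ a b : ℝ, ‖((a : ℂ) + Complex.I * (b : ℂ))‖ ≤ |a| + |b| := by
    intro a b
    calc ‖((a : ℂ) + Complex.I * (b : ℂ))‖ ≤ ‖(a : ℂ)‖ + ‖Complex.I * (b : ℂ)‖ := norm_add_le _ _
      _ = |a| + |b| := by rw [norm_mul, Complex.norm_I, one_mul, Complex.norm_real, Complex.norm_real,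
          Real.norm_eq_abs, Real.norm_eq_abs]
  calc ‖((ksq L n : ℂ) / 2) * ((densityWave 0 n Φ : ℂ) + Complex.I * (densityWave (-(Real.pi / 2)) n Φ : ℂ)) +
        (((phasedCurrent 0 n Φ).im : ℂ) + Complex.I * ((phasedCurrent (-(Real.pi / 2)) n Φ).im : ℂ))‖
      ≤ ‖((ksq L n : ℂ) / 2) * ((densityWave 0 n Φ : ℂ) + Complex.I * (densityWave (-(Real.pi / 2)) n Φ : ℂ))‖ +
          ‖(((phasedCurrent 0 n Φ).im : ℂ) + Complex.I * ((phasedCurrent (-(Real.pi / 2)) n Φ).im : ℂ))‖ :=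
        norm_add_le _ _
    _ ≤ ksq L n / 2 * (|densityWave 0 n Φ| + |densityWave (-(Real.pi / 2)) n Φ|) +
          (|(phasedCurrent 0 n Φ).im| + |(phasedCurrent (-(Real.pi / 2)) n Φ).im|) := by
        refine add_le_add ?_ (h1 _ _)
        rw [norm_mul, show ‖((ksq L n : ℂ) / 2)‖ = ksq L n / 2 by
          rw [norm_div, Complex.norm_real, Real.norm_of_nonneg (ksq_nonneg L n), Complex.norm_two]]
        exact mul_le_mul_of_nonneg_left (h1 _ _) hk
    _ = _ := by ring

/-- The defining identity of the backflow read as `|k|²‖X‖ ≤ ‖kCurrent‖ + ‖R‖`. [folklore] -/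
theorem ksq_mul_norm_condensateSource_le (n : Fin 3 → ℤ) (Φ : PeriodicTrialState N L) :
    ksq L n * ‖condensateSource n Φ‖ ≤ ‖kCurrent n Φ‖ + ‖backflow n Φ‖ := by
  have hid : (ksq L n : ℂ) * condensateSource n Φ = kCurrent n Φ - backflow n Φ := by
    unfold backflow; ring
  calc ksq L n * ‖condensateSource n Φ‖ = ‖(ksq L n : ℂ) * condensateSource n Φ‖ := by
        rw [norm_mul, Complex.norm_real, Real.norm_of_nonneg (ksq_nonneg L n)]
    _ = ‖kCurrent n Φ - backflow n Φ‖ := by rw [hid]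
    _ ≤ ‖kCurrent n Φ‖ + ‖backflow n Φ‖ := norm_sub_le _ _

/-- … and as `‖R‖ ≤ ‖kCurrent‖ + |k|²‖X‖` (for §A). [folklore] -/
theorem norm_backflow_le (n : Fin 3 → ℤ) (Φ : PeriodicTrialState N L) :
    ‖backflow n Φ‖ ≤ ‖kCurrent n Φ‖ + ksq L n * ‖condensateSource n Φ‖ := by
  unfold backflow
  calc ‖kCurrent n Φ - (ksq L n : ℂ) * condensateSource n Φ‖
      ≤ ‖kCurrent n Φ‖ + ‖(ksq L n : ℂ) * condensateSource n Φ‖ := norm_sub_le _ _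
    _ = ‖kCurrent n Φ‖ + ksq L n * ‖condensateSource n Φ‖ := by
        rw [norm_mul, Complex.norm_real, Real.norm_of_nonneg (ksq_nonneg L n)]

/-- Cauchy–Schwarz for five terms. [folklore] -/
theorem sq_sum_five_le (g₁ g₂ g₃ g₄ g₅ : ℝ) :
    (g₁ + g₂ + g₃ + g₄ + g₅) ^ 2 ≤ 5 * (g₁ ^ 2 + g₂ ^ 2 + g₃ ^ 2 + g₄ ^ 2 + g₅ ^ 2) := by
  nlinarith [sq_nonneg (g₁ - g₂), sq_nonneg (g₁ - g₃), sq_nonneg (g₁ - g₄), sq_nonneg (g₁ - g₅),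
    sq_nonneg (g₂ - g₃), sq_nonneg (g₂ - g₄), sq_nonneg (g₂ - g₅), sq_nonneg (g₃ - g₄),
    sq_nonneg (g₃ - g₅), sq_nonneg (g₄ - g₅)]

/-- Five nonnegative terms with square bounds bound the square of anything below their sum. [folklore] -/
theorem sq_le_five_of_le_sum {T g₁ g₂ g₃ g₄ g₅ b₁ b₂ b₃ b₄ b₅ : ℝ} (hT0 : 0 ≤ T)
    (hT : T ≤ g₁ + g₂ + g₃ + g₄ + g₅) (h₁ : g₁ ^ 2 ≤ b₁) (h₂ : g₂ ^ 2 ≤ b₂) (h₃ : g₃ ^ 2 ≤ b₃)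
    (h₄ : g₄ ^ 2 ≤ b₄) (h₅ : g₅ ^ 2 ≤ b₅) : T ^ 2 ≤ 5 * (b₁ + b₂ + b₃ + b₄ + b₅) := by
  have h0 : T ^ 2 ≤ (g₁ + g₂ + g₃ + g₄ + g₅) ^ 2 := pow_le_pow_left₀ hT0 hT 2
  have hcs := sq_sum_five_le g₁ g₂ g₃ g₄ g₅
  linarith

end Lemmas

/-! ### The kernel-checked compositions -/

section Composition

variable {N : ℕ} {L : ℝ}

/-- The density term: from the chord square form `|D|² ≤ 4(C₂ N L²/‖n‖²)d` to
`((|k|²/2)|D|)² ≤ 12π²C₂·(N|k|²)·d`, using `|k|²L²/‖n‖² ≤ 12π²`. [folklore] -/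
theorem density_term_sq {D C₂ Nr q k d : ℝ} (hk : 0 ≤ k) (hd : 0 ≤ d) (hC : 0 ≤ C₂ * Nr)
    (hgeom : k * q ≤ 12 * Real.pi ^ 2) (hD' : |D| ^ 2 ≤ 4 * (C₂ * Nr * q) * d) :
    (k / 2 * |D|) ^ 2 ≤ 12 * Real.pi ^ 2 * C₂ * (Nr * k) * d := by
  have hD : D ^ 2 ≤ 4 * (C₂ * Nr * q) * d := by rwa [sq_abs] at hD'
  have h1 : (k / 2 * |D|) ^ 2 = k ^ 2 / 4 * D ^ 2 := by rw [mul_pow, sq_abs]; ring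
  rw [h1]
  have h2 : k ^ 2 / 4 * D ^ 2 ≤ k ^ 2 / 4 * (4 * (C₂ * Nr * q) * d) :=
    mul_le_mul_of_nonneg_left hD (by positivity)
  have h3 : k ^ 2 / 4 * (4 * (C₂ * Nr * q) * d) = C₂ * Nr * k * d * (k * q) := by ring
  have h4 : 0 ≤ C₂ * Nr * k * d := by positivity
  calc k ^ 2 / 4 * D ^ 2 ≤ C₂ * Nr * k * d * (k * q) := by rw [← h3]; exact h2
    _ ≤ C₂ * Nr * k * d * (12 * Real.pi ^ 2) := mul_le_mul_of_nonneg_left hgeom h4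
    _ = 12 * Real.pi ^ 2 * C₂ * (Nr * k) * d := by ring

/-- `|k|² · L²/‖n‖∞² ≤ 12π²`. [folklore] -/
theorem ksq_mul_geom_le (hL : 0 < L) {n : Fin 3 → ℤ} (hn : n ≠ 0) :
    ksq L n * (L ^ 2 / ‖(fun j => (n j : ℝ))‖ ^ 2) ≤ 12 * Real.pi ^ 2 := by
  calc ksq L n * (L ^ 2 / ‖(fun j => (n j : ℝ))‖ ^ 2)
      ≤ 3 * ksupSq L n * (L ^ 2 / ‖(fun j => (n j : ℝ))‖ ^ 2) :=
        mul_le_mul_of_nonneg_right (ksq_le_three_mul_ksupSq L n) (by positivity)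
    _ = 3 * (ksupSq L n * (L ^ 2 / ‖(fun j => (n j : ℝ))‖ ^ 2)) := by ring
    _ = 12 * Real.pi ^ 2 := by rw [ksupSq_mul hL hn]; ring

/-- **The splitting inequality at one state (square form).** With `d = E(Φ) - E₀` at a finite-energy state: if
`|2 Im W₀|², |2 Im W₁|² ≤ 4c_k d` (Ward), `|D₀|², |D₁|² ≤ 4(C₂N L²/‖n‖²)d` (density), `‖R‖² ≤ 4C₃c_k d` (backflow),
`c_k = N|k|²`, then `(|k|²‖X‖)² ≤ 5(2 + 24π²C₂ + 4C₃)·c_k·d`. -/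
theorem splitting_sq (hL : 0 < L) {d C₂ C₃ : ℝ} {n : Fin 3 → ℤ} (hn : n ≠ 0) {Φ : PeriodicTrialState N L}
    (hd : 0 ≤ d) (hC₂ : 0 ≤ C₂)
    (h₁ : |2 * (phasedCurrent 0 n Φ).im| ^ 2 ≤ 4 * ((N : ℝ) * ksq L n) * d)
    (h₂ : |2 * (phasedCurrent (-(Real.pi / 2)) n Φ).im| ^ 2 ≤ 4 * ((N : ℝ) * ksq L n) * d)
    (h₃ : |densityWave 0 n Φ| ^ 2 ≤ 4 * (C₂ * N * (L ^ 2 / ‖(fun j => (n j : ℝ))‖ ^ 2)) * d)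
    (h₄ : |densityWave (-(Real.pi / 2)) n Φ| ^ 2 ≤ 4 * (C₂ * N * (L ^ 2 / ‖(fun j => (n j : ℝ))‖ ^ 2)) * d)
    (h₅ : ‖backflow n Φ‖ ^ 2 ≤ 4 * (C₃ * ((N : ℝ) * ksq L n)) * d) :
    (ksq L n * ‖condensateSource n Φ‖) ^ 2 ≤ 5 * (2 + 24 * Real.pi ^ 2 * C₂ + 4 * C₃) * ((N : ℝ) * ksq L n) * d := by
  have hK := norm_kCurrent_le n Φ
  have hX := ksq_mul_norm_condensateSource_le n Φ
  have h0 : 0 ≤ ksq L n * ‖condensateSource n Φ‖ := mul_nonneg (ksq_nonneg L n) (norm_nonneg _)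
  have hgeom := ksq_mul_geom_le hL hn
  have hCN : 0 ≤ C₂ * (N : ℝ) := by positivity
  have k₁ := abs_sq_le_of_two_mul h₁
  have k₂ := abs_sq_le_of_two_mul h₂
  have k₃ := density_term_sq (ksq_nonneg L n) hd hCN hgeom h₃
  have k₄ := density_term_sq (ksq_nonneg L n) hd hCN hgeom h₄
  have hT : ksq L n * ‖condensateSource n Φ‖ ≤
      ksq L n / 2 * |densityWave 0 n Φ| + ksq L n / 2 * |densityWave (-(Real.pi / 2)) n Φ| +
        |(phasedCurrent 0 n Φ).im| + |(phasedCurrent (-(Real.pi / 2)) n Φ).im| + ‖backflow n Φ‖ := by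
    linarith [hK, hX]
  have key := sq_le_five_of_le_sum h0 hT k₃ k₄ k₁ k₂ h₅
  linarith

/-- **§A at one state (square form).** Conversely, with the same Ward and density inputs and `(|k|²‖X‖)² ≤ 4Bd`:
`‖R‖² ≤ 5((2 + 24π²C₂)c_k + 4B)·d`. -/
theorem backflow_sq (hL : 0 < L) {d C₂ B : ℝ} {n : Fin 3 → ℤ} (hn : n ≠ 0) {Φ : PeriodicTrialState N L}
    (hd : 0 ≤ d) (hC₂ : 0 ≤ C₂)
    (h₁ : |2 * (phasedCurrent 0 n Φ).im| ^ 2 ≤ 4 * ((N : ℝ) * ksq L n) * d)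
    (h₂ : |2 * (phasedCurrent (-(Real.pi / 2)) n Φ).im| ^ 2 ≤ 4 * ((N : ℝ) * ksq L n) * d)
    (h₃ : |densityWave 0 n Φ| ^ 2 ≤ 4 * (C₂ * N * (L ^ 2 / ‖(fun j => (n j : ℝ))‖ ^ 2)) * d)
    (h₄ : |densityWave (-(Real.pi / 2)) n Φ| ^ 2 ≤ 4 * (C₂ * N * (L ^ 2 / ‖(fun j => (n j : ℝ))‖ ^ 2)) * d)
    (h₅ : (ksq L n * ‖condensateSource n Φ‖) ^ 2 ≤ 4 * B * d) :
    ‖backflow n Φ‖ ^ 2 ≤ 5 * ((2 + 24 * Real.pi ^ 2 * C₂) * ((N : ℝ) * ksq L n) + 4 * B) * d := by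
  have hK := norm_kCurrent_le n Φ
  have hR := norm_backflow_le n Φ
  have hgeom := ksq_mul_geom_le hL hn
  have hCN : 0 ≤ C₂ * (N : ℝ) := by positivity
  have k₁ := abs_sq_le_of_two_mul h₁
  have k₂ := abs_sq_le_of_two_mul h₂
  have k₃ := density_term_sq (ksq_nonneg L n) hd hCN hgeom h₃
  have k₄ := density_term_sq (ksq_nonneg L n) hd hCN hgeom h₄
  have hT : ‖backflow n Φ‖ ≤
      ksq L n / 2 * |densityWave 0 n Φ| + ksq L n / 2 * |densityWave (-(Real.pi / 2)) n Φ| +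
        |(phasedCurrent 0 n Φ).im| + |(phasedCurrent (-(Real.pi / 2)) n Φ).im| +
          ksq L n * ‖condensateSource n Φ‖ := by
    linarith [hK, hR]
  have key := sq_le_five_of_le_sum (norm_nonneg _) hT k₃ k₄ k₁ k₂ h₅
  linarith

/-- **The composition, c-number level**: WardChord ∧ S2 ∧ S3 ⟹ `CNumberGD` with `ρ₀ := min`,
`N₀ := max (max N₂ N₃) 1`, `C := 10 + 120π²C₂ + 20C₃` (from `(|k|²‖X‖)² ≤ 5(2+24π²C₂+4C₃)N|k|²(E-E₀)`,
`k∞² ≤ |k|²` and `k∞²L²/‖n‖² = 4π² ≥ 1`). -/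
theorem cnumberGD_of (h₁ : WardChord) (h₂ : WeakDensityChord) (h₃ : BackflowChord) : CNumberGD := by
  intro v hv M hM
  obtain ⟨ρ₂, C₂, hρ₂, hC₂, N₂, hD⟩ := h₂ v hv M hM
  obtain ⟨ρ₃, C₃, hρ₃, hC₃, N₃, hB⟩ := h₃ v hv M hM
  refine ⟨min ρ₂ ρ₃, 10 + 120 * Real.pi ^ 2 * C₂ + 20 * C₃, lt_min hρ₂ hρ₃, by positivity,
    max (max N₂ N₃) 1, ?_⟩
  intro N hN L hL hNL n hn hwin s hs Φ
  have hN₂ : N₂ ≤ N := ((le_max_left _ _).trans (le_max_left _ _)).trans hN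
  have hN₃ : N₃ ≤ N := ((le_max_right _ _).trans (le_max_left _ _)).trans hN
  have hN1 : 1 ≤ N := (le_max_right _ _).trans hN
  have hL3 : (0 : ℝ) ≤ L ^ 3 := by positivity
  have hNL₂ : (N : ℝ) ≤ ρ₂ * L ^ 3 := hNL.trans (mul_le_mul_of_nonneg_right (min_le_left _ _) hL3)
  have hNL₃ : (N : ℝ) ≤ ρ₃ * L ^ 3 := hNL.trans (mul_le_mul_of_nonneg_right (min_le_right _ _) hL3)
  -- infinite energy: nothing to prove
  by_cases hE : periodicEnergy v Φ = ⊤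
  · rw [hE, top_add]; exact le_top
  have hE₀E : periodicGroundStateEnergy v N L ≤ periodicEnergy v Φ := periodicGroundStateEnergy_le v Φ
  -- positivity
  have hNr : (1 : ℝ) ≤ N := by exact_mod_cast hN1
  have hk : 0 < ksq L n := ksq_pos hL.ne' hn
  have hck : 0 < (N : ℝ) * ksq L n := mul_pos (by linarith) hk
  have hnorm : 0 < ‖(fun j => (n j : ℝ))‖ := lt_of_lt_of_le one_pos (one_le_norm_intVec hn)
  have hcD : 0 < C₂ * N * (L ^ 2 / ‖(fun j => (n j : ℝ))‖ ^ 2) := by positivity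
  set d := (periodicEnergy v Φ).toReal - (periodicGroundStateEnergy v N L).toReal with hd
  have hd0 : 0 ≤ d := sub_nonneg.mpr (ENNReal.toReal_mono hE hE₀E)
  -- square forms of the five chords at `Φ`
  have q₁ : |2 * (phasedCurrent 0 n Φ).im| ^ 2 ≤ 4 * ((N : ℝ) * ksq L n) * d :=
    sq_le_of_ennreal_chords hE hE₀E (abs_nonneg _) hck fun s' hs' => by
      have h := h₁ v N L n 0 s' hs' Φ
      rwa [show s' ^ 2 * ((N : ℝ) * ksq L n) = (N : ℝ) * ksq L n * s' ^ 2 by ring] at h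
  have q₂ : |2 * (phasedCurrent (-(Real.pi / 2)) n Φ).im| ^ 2 ≤ 4 * ((N : ℝ) * ksq L n) * d :=
    sq_le_of_ennreal_chords hE hE₀E (abs_nonneg _) hck fun s' hs' => by
      have h := h₁ v N L n (-(Real.pi / 2)) s' hs' Φ
      rwa [show s' ^ 2 * ((N : ℝ) * ksq L n) = (N : ℝ) * ksq L n * s' ^ 2 by ring] at h
  have q₃ : |densityWave 0 n Φ| ^ 2 ≤ 4 * (C₂ * N * (L ^ 2 / ‖(fun j => (n j : ℝ))‖ ^ 2)) * d :=
    sq_le_of_ennreal_chords hE hE₀E (abs_nonneg _) hcD fun s' hs' => by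
      have h := hD N hN₂ L hL hNL₂ n hn hwin 0 s' hs' Φ
      rwa [show C₂ * s' ^ 2 * (N : ℝ) * L ^ 2 / ‖(fun j => (n j : ℝ))‖ ^ 2 =
        C₂ * N * (L ^ 2 / ‖(fun j => (n j : ℝ))‖ ^ 2) * s' ^ 2 by ring] at h
  have q₄ : |densityWave (-(Real.pi / 2)) n Φ| ^ 2 ≤ 4 * (C₂ * N * (L ^ 2 / ‖(fun j => (n j : ℝ))‖ ^ 2)) * d :=
    sq_le_of_ennreal_chords hE hE₀E (abs_nonneg _) hcD fun s' hs' => by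
      have h := hD N hN₂ L hL hNL₂ n hn hwin (-(Real.pi / 2)) s' hs' Φ
      rwa [show C₂ * s' ^ 2 * (N : ℝ) * L ^ 2 / ‖(fun j => (n j : ℝ))‖ ^ 2 =
        C₂ * N * (L ^ 2 / ‖(fun j => (n j : ℝ))‖ ^ 2) * s' ^ 2 by ring] at h
  have q₅ : ‖backflow n Φ‖ ^ 2 ≤ 4 * (C₃ * ((N : ℝ) * ksq L n)) * d :=
    sq_le_of_ennreal_chords hE hE₀E (norm_nonneg _) (mul_pos hC₃ hck) fun s' hs' => by
      have h := hB N hN₃ L hL hNL₃ n hn hwin s' hs' Φ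
      rwa [show C₃ * s' ^ 2 * ((N : ℝ) * ksq L n) = C₃ * ((N : ℝ) * ksq L n) * s' ^ 2 by ring] at h
  -- the splitting inequality and the passage to the crux's budget
  have key := splitting_sq hL hn hd0 hC₂.le q₁ q₂ q₃ q₄ q₅
  set F := ‖condensateSource n Φ‖ with hF
  have hF0 : 0 ≤ F := norm_nonneg _
  set K := 2 + 24 * Real.pi ^ 2 * C₂ + 4 * C₃ with hK
  have hK0 : 0 ≤ K := by positivity
  -- `k∞² F² ≤ |k|² F² ≤ 5K N d`
  have hk1 : ksq L n * F ^ 2 ≤ 5 * K * N * d := by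
    have h1 : ksq L n * (ksq L n * F ^ 2) ≤ ksq L n * (5 * K * N * d) := by
      calc ksq L n * (ksq L n * F ^ 2) = (ksq L n * F) ^ 2 := by ring
        _ ≤ 5 * K * ((N : ℝ) * ksq L n) * d := key
        _ = ksq L n * (5 * K * N * d) := by ring
    exact le_of_mul_le_mul_left h1 hk
  have hk2 : ksupSq L n * F ^ 2 ≤ 5 * K * N * d :=
    (mul_le_mul_of_nonneg_right (ksupSq_le_ksq L n) (sq_nonneg F)).trans hk1
  -- multiply by `L²/‖n‖²` and use `k∞² L²/‖n‖² = 4π² ≥ 1`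
  have hq : 0 ≤ L ^ 2 / ‖(fun j => (n j : ℝ))‖ ^ 2 := by positivity
  have hk3 : 4 * Real.pi ^ 2 * F ^ 2 ≤ 5 * K * N * d * (L ^ 2 / ‖(fun j => (n j : ℝ))‖ ^ 2) := by
    have h1 := mul_le_mul_of_nonneg_right hk2 hq
    calc 4 * Real.pi ^ 2 * F ^ 2 = ksupSq L n * (L ^ 2 / ‖(fun j => (n j : ℝ))‖ ^ 2) * F ^ 2 := by
          rw [ksupSq_mul hL hn]
      _ = ksupSq L n * F ^ 2 * (L ^ 2 / ‖(fun j => (n j : ℝ))‖ ^ 2) := by ring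
      _ ≤ 5 * K * N * d * (L ^ 2 / ‖(fun j => (n j : ℝ))‖ ^ 2) := h1
  have hπ : (1 : ℝ) ≤ 4 * Real.pi ^ 2 := by nlinarith [Real.pi_gt_three]
  have hKd : 0 ≤ 5 * K * N * d * (L ^ 2 / ‖(fun j => (n j : ℝ))‖ ^ 2) := by positivity
  have hsq : F ^ 2 ≤ 4 * ((10 + 120 * Real.pi ^ 2 * C₂ + 20 * C₃) * N * L ^ 2 / ‖(fun j => (n j : ℝ))‖ ^ 2) * d := by
    have h2 : F ^ 2 ≤ 4 * Real.pi ^ 2 * F ^ 2 := le_mul_of_one_le_left (sq_nonneg F) hπ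
    have h3 : 5 * K * N * d * (L ^ 2 / ‖(fun j => (n j : ℝ))‖ ^ 2) ≤
        4 * (5 * K * N * d * (L ^ 2 / ‖(fun j => (n j : ℝ))‖ ^ 2)) := le_mul_of_one_le_left hKd (by norm_num)
    have h4 : 4 * (5 * K * N * d * (L ^ 2 / ‖(fun j => (n j : ℝ))‖ ^ 2)) =
        4 * ((10 + 120 * Real.pi ^ 2 * C₂ + 20 * C₃) * N * L ^ 2 / ‖(fun j => (n j : ℝ))‖ ^ 2) * d := by
      rw [hK]; ring
    linarith
  -- back to the chord at the given `s`
  have hc : 0 < (10 + 120 * Real.pi ^ 2 * C₂ + 20 * C₃) * N * L ^ 2 / ‖(fun j => (n j : ℝ))‖ ^ 2 := by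
    positivity
  have hreal := forall_chord_of_sq_le hc hsq s
  refine (ennreal_chord_iff hE hE₀E (mul_nonneg hs hF0) (by positivity)).mpr ?_
  have e1 : (10 + 120 * Real.pi ^ 2 * C₂ + 20 * C₃) * s ^ 2 * (N : ℝ) * L ^ 2 / ‖(fun j => (n j : ℝ))‖ ^ 2 =
      (10 + 120 * Real.pi ^ 2 * C₂ + 20 * C₃) * N * L ^ 2 / ‖(fun j => (n j : ℝ))‖ ^ 2 * s ^ 2 := by ring
  rw [e1]
  linarith

/-- **§A of triage r1-3 as a theorem**: conversely WardChord ∧ S2 ∧ `CNumberGD` ⟹ S3 (`‖R‖ ≤ ‖kCurrent‖ + |k|²‖X‖`,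
`|k|² L²/‖n‖² ≤ 12π²`); so, modulo the (proved) Ward chord and the density chord, the backflow chord and c-number
Gaussian domination are EQUIVALENT. Constants: `C₃ := 2(2 + 24π²C₂ + 48π²C_X)`. -/
theorem backflowChord_of_cnumberGD (h₁ : WardChord) (h₂ : WeakDensityChord) (hX : CNumberGD) :
    BackflowChord := by
  intro v hv M hM
  obtain ⟨ρ₂, C₂, hρ₂, hC₂, N₂, hD⟩ := h₂ v hv M hM
  obtain ⟨ρ₃, C₃, hρ₃, hC₃, N₃, hC⟩ := hX v hv M hM
  refine ⟨min ρ₂ ρ₃, 2 * (2 + 24 * Real.pi ^ 2 * C₂ + 48 * Real.pi ^ 2 * C₃), lt_min hρ₂ hρ₃, by positivity,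
    max (max N₂ N₃) 1, ?_⟩
  intro N hN L hL hNL n hn hwin s hs Φ
  have hN₂ : N₂ ≤ N := ((le_max_left _ _).trans (le_max_left _ _)).trans hN
  have hN₃ : N₃ ≤ N := ((le_max_right _ _).trans (le_max_left _ _)).trans hN
  have hN1 : 1 ≤ N := (le_max_right _ _).trans hN
  have hL3 : (0 : ℝ) ≤ L ^ 3 := by positivity
  have hNL₂ : (N : ℝ) ≤ ρ₂ * L ^ 3 := hNL.trans (mul_le_mul_of_nonneg_right (min_le_left _ _) hL3)
  have hNL₃ : (N : ℝ) ≤ ρ₃ * L ^ 3 := hNL.trans (mul_le_mul_of_nonneg_right (min_le_right _ _) hL3)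
  by_cases hE : periodicEnergy v Φ = ⊤
  · rw [hE, top_add]; exact le_top
  have hE₀E : periodicGroundStateEnergy v N L ≤ periodicEnergy v Φ := periodicGroundStateEnergy_le v Φ
  have hNr : (1 : ℝ) ≤ N := by exact_mod_cast hN1
  have hk : 0 < ksq L n := ksq_pos hL.ne' hn
  have hck : 0 < (N : ℝ) * ksq L n := mul_pos (by linarith) hk
  have hnorm : 0 < ‖(fun j => (n j : ℝ))‖ := lt_of_lt_of_le one_pos (one_le_norm_intVec hn)
  have hcD : 0 < C₂ * N * (L ^ 2 / ‖(fun j => (n j : ℝ))‖ ^ 2) := by positivity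
  set d := (periodicEnergy v Φ).toReal - (periodicGroundStateEnergy v N L).toReal with hd
  have hd0 : 0 ≤ d := sub_nonneg.mpr (ENNReal.toReal_mono hE hE₀E)
  have q₁ : |2 * (phasedCurrent 0 n Φ).im| ^ 2 ≤ 4 * ((N : ℝ) * ksq L n) * d :=
    sq_le_of_ennreal_chords hE hE₀E (abs_nonneg _) hck fun s' hs' => by
      have h := h₁ v N L n 0 s' hs' Φ
      rwa [show s' ^ 2 * ((N : ℝ) * ksq L n) = (N : ℝ) * ksq L n * s' ^ 2 by ring] at h
  have q₂ : |2 * (phasedCurrent (-(Real.pi / 2)) n Φ).im| ^ 2 ≤ 4 * ((N : ℝ) * ksq L n) * d :=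
    sq_le_of_ennreal_chords hE hE₀E (abs_nonneg _) hck fun s' hs' => by
      have h := h₁ v N L n (-(Real.pi / 2)) s' hs' Φ
      rwa [show s' ^ 2 * ((N : ℝ) * ksq L n) = (N : ℝ) * ksq L n * s' ^ 2 by ring] at h
  have q₃ : |densityWave 0 n Φ| ^ 2 ≤ 4 * (C₂ * N * (L ^ 2 / ‖(fun j => (n j : ℝ))‖ ^ 2)) * d :=
    sq_le_of_ennreal_chords hE hE₀E (abs_nonneg _) hcD fun s' hs' => by
      have h := hD N hN₂ L hL hNL₂ n hn hwin 0 s' hs' Φ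
      rwa [show C₂ * s' ^ 2 * (N : ℝ) * L ^ 2 / ‖(fun j => (n j : ℝ))‖ ^ 2 =
        C₂ * N * (L ^ 2 / ‖(fun j => (n j : ℝ))‖ ^ 2) * s' ^ 2 by ring] at h
  have q₄ : |densityWave (-(Real.pi / 2)) n Φ| ^ 2 ≤ 4 * (C₂ * N * (L ^ 2 / ‖(fun j => (n j : ℝ))‖ ^ 2)) * d :=
    sq_le_of_ennreal_chords hE hE₀E (abs_nonneg _) hcD fun s' hs' => by
      have h := hD N hN₂ L hL hNL₂ n hn hwin (-(Real.pi / 2)) s' hs' Φ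
      rwa [show C₂ * s' ^ 2 * (N : ℝ) * L ^ 2 / ‖(fun j => (n j : ℝ))‖ ^ 2 =
        C₂ * N * (L ^ 2 / ‖(fun j => (n j : ℝ))‖ ^ 2) * s' ^ 2 by ring] at h
  have hcX : 0 < C₃ * N * L ^ 2 / ‖(fun j => (n j : ℝ))‖ ^ 2 := by positivity
  have q₅ : ‖condensateSource n Φ‖ ^ 2 ≤ 4 * (C₃ * N * L ^ 2 / ‖(fun j => (n j : ℝ))‖ ^ 2) * d :=
    sq_le_of_ennreal_chords hE hE₀E (norm_nonneg _) hcX fun s' hs' => by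
      have h := hC N hN₃ L hL hNL₃ n hn hwin s' hs' Φ
      rwa [show C₃ * s' ^ 2 * (N : ℝ) * L ^ 2 / ‖(fun j => (n j : ℝ))‖ ^ 2 =
        C₃ * N * L ^ 2 / ‖(fun j => (n j : ℝ))‖ ^ 2 * s' ^ 2 by ring] at h
  set F := ‖condensateSource n Φ‖ with hF
  -- `(|k|²‖X‖)² ≤ 4 C₃ N (|k|² L²/‖n‖²) |k|² d ≤ 4 (12π² C₃ N|k|²) d`
  have hgeom := ksq_mul_geom_le hL hn
  have q₅' : (ksq L n * F) ^ 2 ≤ 4 * (12 * Real.pi ^ 2 * C₃ * ((N : ℝ) * ksq L n)) * d := by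
    have h1 : ksq L n * F ^ 2 ≤ ksq L n * (4 * (C₃ * N * L ^ 2 / ‖(fun j => (n j : ℝ))‖ ^ 2) * d) :=
      mul_le_mul_of_nonneg_left q₅ hk.le
    have h2 : ksq L n * (4 * (C₃ * N * L ^ 2 / ‖(fun j => (n j : ℝ))‖ ^ 2) * d) =
        4 * C₃ * N * d * (ksq L n * (L ^ 2 / ‖(fun j => (n j : ℝ))‖ ^ 2)) := by ring
    have h3 : 0 ≤ 4 * C₃ * N * d := by positivity
    have h4 : 4 * C₃ * N * d * (ksq L n * (L ^ 2 / ‖(fun j => (n j : ℝ))‖ ^ 2)) ≤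
        4 * C₃ * N * d * (12 * Real.pi ^ 2) := mul_le_mul_of_nonneg_left hgeom h3
    have h5 : ksq L n * F ^ 2 ≤ 4 * C₃ * N * d * (12 * Real.pi ^ 2) := by linarith
    have h6 := mul_le_mul_of_nonneg_left h5 hk.le
    calc (ksq L n * F) ^ 2 = ksq L n * (ksq L n * F ^ 2) := by ring
      _ ≤ ksq L n * (4 * C₃ * N * d * (12 * Real.pi ^ 2)) := h6
      _ = 4 * (12 * Real.pi ^ 2 * C₃ * ((N : ℝ) * ksq L n)) * d := by ring
  have key := backflow_sq hL hn hd0 hC₂.le q₁ q₂ q₃ q₄ q₅'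
  have hsqR : ‖backflow n Φ‖ ^ 2 ≤
      4 * (2 * (2 + 24 * Real.pi ^ 2 * C₂ + 48 * Real.pi ^ 2 * C₃) * ((N : ℝ) * ksq L n)) * d := by
    have h0 : 0 ≤ (2 + 24 * Real.pi ^ 2 * C₂ + 48 * Real.pi ^ 2 * C₃) * ((N : ℝ) * ksq L n) * d := by positivity
    have h1 : 5 * ((2 + 24 * Real.pi ^ 2 * C₂) * ((N : ℝ) * ksq L n) +
        4 * (12 * Real.pi ^ 2 * C₃ * ((N : ℝ) * ksq L n))) * d
        = 5 * ((2 + 24 * Real.pi ^ 2 * C₂ + 48 * Real.pi ^ 2 * C₃) * ((N : ℝ) * ksq L n) * d) := by ring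
    have h2 : 4 * (2 * (2 + 24 * Real.pi ^ 2 * C₂ + 48 * Real.pi ^ 2 * C₃) * ((N : ℝ) * ksq L n)) * d
        = 8 * ((2 + 24 * Real.pi ^ 2 * C₂ + 48 * Real.pi ^ 2 * C₃) * ((N : ℝ) * ksq L n) * d) := by ring
    linarith
  have hc : 0 < 2 * (2 + 24 * Real.pi ^ 2 * C₂ + 48 * Real.pi ^ 2 * C₃) * ((N : ℝ) * ksq L n) := by positivity
  have hreal := forall_chord_of_sq_le hc hsqR s
  refine (ennreal_chord_iff hE hE₀E (mul_nonneg hs (norm_nonneg _)) (by positivity)).mpr ?_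
  have e1 : 2 * (2 + 24 * Real.pi ^ 2 * C₂ + 48 * Real.pi ^ 2 * C₃) * s ^ 2 * ((N : ℝ) * ksq L n) =
      2 * (2 + 24 * Real.pi ^ 2 * C₂ + 48 * Real.pi ^ 2 * C₃) * ((N : ℝ) * ksq L n) * s ^ 2 := by ring
  rw [e1]
  linarith

end Composition

/-- **The composition**: the three stubs imply the crux BY NAME — the proved Ward chord `wardChord` (S1) and the stubs
S2, S3 give `CNumberGD` (`cnumberGD_of`), the lift S4 turns it into `∀ v M ∃ ρ₀ C N₀, GDCanWith ρ₀ C N₀ v M`, and the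
disprover's `gaussianDominationCan_iff` (`Iff.rfl`) identifies that with the route decl. [folklore] -/
theorem gaussianDominationCan_of_stubs :
    Goal.stub_weakDensityChord → Goal.stub_backflowChord → Goal.stub_normalisationLift →
      BECThomsonPrinciple.GaussianDominationCan :=
  fun h₂ h₃ h₄ => gaussianDominationCan_iff.mpr (h₄ (cnumberGD_of wardChord_holds h₂ h₃))

end Summit.AtomisticToContinuum.BoseEinsteinCondensation.Cruxes.GaussianDominationCan.WardChordSplitting

end
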